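import Summits.CriticalPhenomena.PercolationContinuityZ3.Theorems.PercNearOneGluingNoHeavyLowerTailHubPairApexMain
import HarnessLib

/-!
# `NoHeavyLowerTail` (stmt-CriticalPhenomena-4575) — HUB PAIRS WITH THE APEX ALONE ON ITS SIDE, part 5:
# APEX-ARM FOLDING — the truth of R1 depends on the apex arm only through the ratio `(∑ η : BondConfig V, rcWeightW wA q ({h₁, h₂} : Set V) η * ind {η : BondConfig V | h₁ ∈ cl η.toFinset a ∧ h₂ ∈ cl η.toFinset a} η) : (∑ η : BondConfig V, rcWeightW wA q ({h₁, h₂} : Set V) η * ind {η : BondConfig V | h₁ ∈ cl η.toFinset a ∧ h₂ ∉ cl η.toFinset a} η) : (∑ η : BondConfig V, rcWeightW wA q ({h₁, h₂} : Set V) η * ind {η : BondConfig V | h₁ ∉ cl η.toFinset a ∧ h₂ ∈ cl η.toFinset a} η)`,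
# and every ratio is realised by the two pendant pairs `{ah₁, ah₂}`

Support file (prover prim-gen-kcluster gen 72; `--supports stmt-CriticalPhenomena-4575`).  No definitions, no named facts, no sorries.
Notation of parts 1–3.  By the dictionary (`HubPairApex.sum_eq`) and the vanishing of the rows `B, E` on the cells,
`K·Z(E) = (∑ η : BondConfig V, rcWeightW wA q ({h₁, h₂} : Set V) η * ind {η : BondConfig V | h₁ ∈ cl η.toFinset a ∧ h₂ ∈ cl η.toFinset a} η) R_A(E) + (∑ η : BondConfig V, rcWeightW wA q ({h₁, h₂} : Set V) η * ind {η : BondConfig V | h₁ ∈ cl η.toFinset a ∧ h₂ ∉ cl η.toFinset a} η) R_C(E) + (∑ η : BondConfig V, rcWeightW wA q ({h₁, h₂} : Set V) η * ind {η : BondConfig V | h₁ ∉ cl η.toFinset a ∧ h₂ ∈ cl η.toFinset a} η) R_D(E)` for the four R1 cells `E` (`cell_sums`), where the reference functionals `R_s` do NOT depend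
on the apex arm.  Hence (`r1_iff_of_proportional`): two apex arms glued to the same rest whose wired masses `((∑ η : BondConfig V, rcWeightW wA q ({h₁, h₂} : Set V) η * ind {η : BondConfig V | h₁ ∈ cl η.toFinset a ∧ h₂ ∈ cl η.toFinset a} η), (∑ η : BondConfig V, rcWeightW wA q ({h₁, h₂} : Set V) η * ind {η : BondConfig V | h₁ ∈ cl η.toFinset a ∧ h₂ ∉ cl η.toFinset a} η), (∑ η : BondConfig V, rcWeightW wA q ({h₁, h₂} : Set V) η * ind {η : BondConfig V | h₁ ∉ cl η.toFinset a ∧ h₂ ∈ cl η.toFinset a} η))`, `((∑ η : BondConfig V, rcWeightW wA q ({h₁, h₂} : Set V) η * ind {η : BondConfig V | h₁ ∈ cl η.toFinset a ∧ h₂ ∈ cl η.toFinset a} η)', (∑ η : BondConfig V, rcWeightW wA q ({h₁, h₂} : Set V) η * ind {η : BondConfig V | h₁ ∈ cl η.toFinset a ∧ h₂ ∉ cl η.toFinset a} η)', (∑ η : BondConfig V, rcWeightW wA q ({h₁, h₂} : Set V) η * ind {η : BondConfig V | h₁ ∉ cl η.toFinset a ∧ h₂ ∈ cl η.toFinset a}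 η)')`
are PROPORTIONAL (`(∑ η : BondConfig V, rcWeightW wA q ({h₁, h₂} : Set V) η * ind {η : BondConfig V | h₁ ∈ cl η.toFinset a ∧ h₂ ∉ cl η.toFinset a} η)' (∑ η : BondConfig V, rcWeightW wA q ({h₁, h₂} : Set V) η * ind {η : BondConfig V | h₁ ∈ cl η.toFinset a ∧ h₂ ∈ cl η.toFinset a} η) = (∑ η : BondConfig V, rcWeightW wA q ({h₁, h₂} : Set V) η * ind {η : BondConfig V | h₁ ∈ cl η.toFinset a ∧ h₂ ∈ cl η.toFinset a} η)' (∑ η : BondConfig V, rcWeightW wA q ({h₁, h₂} : Set V) η * ind {η : BondConfig V | h₁ ∈ cl η.toFinset a ∧ h₂ ∉ cl η.toFinset a} η)`, `(∑ η : BondConfig V, rcWeightW wA q ({h₁, h₂} : Set V) η * ind {η : BondConfig V | h₁ ∉ cl η.toFinset a ∧ h₂ ∈ cl η.toFinset a} η)' (∑ η : BondConfig V, rcWeightW wA q ({h₁, h₂} : Set V) η * ind {η : BondConfig V | h₁ ∈ cl η.toFinset a ∧ h₂ ∈ cl η.toFinset a} η) = (∑ η : BondConfig V, rcWeightW wA q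 ({h₁, h₂} : Set V) η * ind {η : BondConfig V | h₁ ∈ cl η.toFinset a ∧ h₂ ∈ cl η.toFinset a} η)' (∑ η : BondConfig V, rcWeightW wA q ({h₁, h₂} : Set V) η * ind {η : BondConfig V | h₁ ∉ cl η.toFinset a ∧ h₂ ∈ cl η.toFinset a} η)`, `(∑ η : BondConfig V, rcWeightW wA q ({h₁, h₂} : Set V) η * ind {η : BondConfig V | h₁ ∈ cl η.toFinset a ∧ h₂ ∈ cl η.toFinset a} η), (∑ η : BondConfig V, rcWeightW wA q ({h₁, h₂} : Set V) η * ind {η : BondConfig V | h₁ ∈ cl η.toFinset a ∧ h₂ ∈ cl η.toFinset a} η)' ≠ 0`) give glued graphs on which R1 for `(a; b, c)` is EQUIVALENT.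
The GADGET ARM `{ah₁, ah₂}` with parameters `p₁, p₂` has `((∑ η : BondConfig V, rcWeightW wA q ({h₁, h₂} : Set V) η * ind {η : BondConfig V | h₁ ∈ cl η.toFinset a ∧ h₂ ∈ cl η.toFinset a} η)', (∑ η : BondConfig V, rcWeightW wA q ({h₁, h₂} : Set V) η * ind {η : BondConfig V | h₁ ∈ cl η.toFinset a ∧ h₂ ∉ cl η.toFinset a} η)', (∑ η : BondConfig V, rcWeightW wA q ({h₁, h₂} : Set V) η * ind {η : BondConfig V | h₁ ∉ cl η.toFinset a ∧ h₂ ∈ cl η.toFinset a} η)') = κ·(p₁p₂, p₁(1−p₂), (1−p₁)p₂)` (`gadget_masses`), so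
(`r1_iff_gadget`) with `p₁ ((∑ η : BondConfig V, rcWeightW wA q ({h₁, h₂} : Set V) η * ind {η : BondConfig V | h₁ ∈ cl η.toFinset a ∧ h₂ ∈ cl η.toFinset a} η) + (∑ η : BondConfig V, rcWeightW wA q ({h₁, h₂} : Set V) η * ind {η : BondConfig V | h₁ ∉ cl η.toFinset a ∧ h₂ ∈ cl η.toFinset a} η)) = (∑ η : BondConfig V, rcWeightW wA q ({h₁, h₂} : Set V) η * ind {η : BondConfig V | h₁ ∈ cl η.toFinset a ∧ h₂ ∈ cl η.toFinset a} η)`, `p₂ ((∑ η : BondConfig V, rcWeightW wA q ({h₁, h₂} : Set V) η * ind {η : BondConfig V | h₁ ∈ cl η.toFinset a ∧ h₂ ∈ cl η.toFinset a} η) + (∑ η : BondConfig V, rcWeightW wA q ({h₁, h₂} : Set V) η * ind {η : BondConfig V | h₁ ∈ cl η.toFinset a ∧ h₂ ∉ cl η.toFinset a} η)) = (∑ η : BondConfig V, rcWeightW wA q ({h₁, h₂} : Set V) η * ind {η : BondConfig V | h₁ ∈ cl η.toFinset a ∧ h₂ ∈ cl η.toFinset a} η)` — such `p₁, p₂ ∈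 [0,1]` always exist (`exists_gadget_weight`) —
R1 for the glued graph is equivalent to R1 for the graph in which the whole apex arm is replaced by the path `h₁ – a – h₂`.
CONSEQUENCE: in a minimal counterexample to R1-RC(q) a hub pair `{h₁,h₂}` with the apex alone on its side has the trivial side `{ah₁, ah₂}`
(the apex has degree 2); equivalently, R1-RC for graphs whose apex has degree 2 implies R1-RC for all graphs with an apex-isolating hub pair.
-/

noncomputable section

namespace Summit.CriticalPhenomena.PercolationContinuityZ3.Theorems

namespace HubPairApex

open Finset SimpleGraph Literature.Probability.Percolation Literature.Probability.Percolation.Gladkov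
open Literature.Probability.Percolation.BHK2006 (weight)
open Literature.Probability.Percolation.DecisionTree (ind ind_of_mem ind_of_not_mem ind_nonneg)
open Literature.Probability.LatticeModels RefinedRowR3 ThreePointLB APL MeasureTheory
open scoped Classical

variable {V : Type*} [Fintype V]

/-! ### The three-term dictionary of the cells -/

section CellSums

variable {DA DY : Finset (Sym2 V)} {a h₁ h₂ b c : V} (h12 : h₁ ≠ h₂) (ha1 : a ≠ h₁) (ha2 : a ≠ h₂) (hab : a ≠ b) (hac : a ≠ c)
  (hsepD : ∀ z : V, (∃ e ∈ DA, z ∈ e) → (∃ e ∈ DY, z ∈ e) → (z = h₁ ∨ z = h₂)) (haY : ∀ e ∈ DY, a ∉ e)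
  (hb : ∀ e ∈ DA, b ∈ e → (b = h₁ ∨ b = h₂)) (hc : ∀ e ∈ DA, c ∈ e → (c = h₁ ∨ c = h₂)) (hbc : c ∈ cl DY b)
  (w wA wY : Sym2 V → unitInterval) {q : ℝ} (hq : 0 < q)
  (hw : ∀ e, e ∉ (↑DA ∪ ↑DY : Set (Sym2 V)) → (w e : ℝ) = 0)
  (hX : ∀ e ∈ (↑DA : Set (Sym2 V)), wA e = w e) (hX' : ∀ e ∉ (↑DA : Set (Sym2 V)), wA e = 0)
  (hY : ∀ e ∈ (↑DA : Set (Sym2 V)), wY e = 0) (hY' : ∀ e ∉ (↑DA : Set (Sym2 V)), wY e = w e)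
include h12 ha1 ha2 hab hac hsepD haY hb hc hbc hw hX hX' hY hY'

/-- **The cells see the apex arm only through `(∑ η : BondConfig V, rcWeightW wA q ({h₁, h₂} : Set V) η * ind {η : BondConfig V | h₁ ∈ cl η.toFinset a ∧ h₂ ∈ cl η.toFinset a} η), (∑ η : BondConfig V, rcWeightW wA q ({h₁, h₂} : Set V) η * ind {η : BondConfig V | h₁ ∈ cl η.toFinset a ∧ h₂ ∉ cl η.toFinset a} η), (∑ η : BondConfig V, rcWeightW wA q ({h₁, h₂} : Set V) η * ind {η : BondConfig V | h₁ ∉ cl η.toFinset a ∧ h₂ ∈ cl η.toFinset a} η)`**: `K·Z(E) = (∑ η : BondConfig V, rcWeightW wA q ({h₁, h₂} : Set V) η * ind {η : BondConfig V | h₁ ∈ cl η.toFinset a ∧ h₂ ∈ cl η.toFinset a} η) R_A(E) + (∑ η : BondConfig V, rcWeightW wA q ({h₁, h₂} : Set V) η * ind {η : BondConfig V | h₁ ∈ cl η.toFinset a ∧ h₂ ∉ cl η.toFinset a} η) R_C(E) + (∑ η : BondConfig V, rcWeightW wA q ({h₁, h₂} : Set V) η * ind {η : BondConfig V | h₁ ∉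 cl η.toFinset a ∧ h₂ ∈ cl η.toFinset a} η) R_D(E)` for the four R1 cells. [this work] -/
theorem cell_sums :
    (∑ ω : BondConfig V, rcWeightW w q ∅ ω * ind {η : BondConfig V | b ∈ cl η.toFinset a ∧ c ∈ cl η.toFinset a} ω) * q ^ clusterCount (∅ : BondConfig V) ({h₁, h₂} : Set V) = (∑ η : BondConfig V, rcWeightW wA q ({h₁, h₂} : Set V) η * ind {η : BondConfig V | h₁ ∈ cl η.toFinset a ∧ h₂ ∈ cl η.toFinset a} η) * (∑ η : BondConfig V, rcWeightW wY q ({h₁, h₂} : Set V) η * ind {η : BondConfig V | ({s(a, h₁), s(a, h₂)} : Set (Sym2 V)) ∪ η ∈ {η : BondConfig V | b ∈ cl η.toFinset a ∧ c ∈ cl η.toFinset a}} η) + (∑ η : BondConfig V, rcWeightW wA q ({h₁, h₂} : Set V) η * ind {η : BondConfig V | h₁ ∈ cl η.toFinset a ∧ h₂ ∉ cl η.toFinset a} η) * (∑ η : BondConfig V, rcWeightW wY q ({h₁, h₂} : Set V) η * (ind {η : BondConfig V | ({s(a, h₁)} : Set (Sym2 V)) ∪ η ∈ {η : BondConfig V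 | b ∈ cl η.toFinset a ∧ c ∈ cl η.toFinset a}} η * (if η ∈ {η : BondConfig V | h₂ ∈ cl η.toFinset h₁} then 1 else q))) + (∑ η : BondConfig V, rcWeightW wA q ({h₁, h₂} : Set V) η * ind {η : BondConfig V | h₁ ∉ cl η.toFinset a ∧ h₂ ∈ cl η.toFinset a} η) * (∑ η : BondConfig V, rcWeightW wY q ({h₁, h₂} : Set V) η * (ind {η : BondConfig V | ({s(a, h₂)} : Set (Sym2 V)) ∪ η ∈ {η : BondConfig V | b ∈ cl η.toFinset a ∧ c ∈ cl η.toFinset a}} η * (if η ∈ {η : BondConfig V | h₂ ∈ cl η.toFinset h₁} then 1 else q))) ∧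
    (∑ ω : BondConfig V, rcWeightW w q ∅ ω * ind {η : BondConfig V | b ∈ cl η.toFinset a ∧ c ∉ cl η.toFinset a} ω) * q ^ clusterCount (∅ : BondConfig V) ({h₁, h₂} : Set V) = (∑ η : BondConfig V, rcWeightW wA q ({h₁, h₂} : Set V) η * ind {η : BondConfig V | h₁ ∈ cl η.toFinset a ∧ h₂ ∈ cl η.toFinset a} η) * (∑ η : BondConfig V, rcWeightW wY q ({h₁, h₂} : Set V) η * ind {η : BondConfig V | ({s(a, h₁), s(a, h₂)} : Set (Sym2 V)) ∪ η ∈ {η : BondConfig V | b ∈ cl η.toFinset a ∧ c ∉ cl η.toFinset a}} η) + (∑ η : BondConfig V, rcWeightW wA q ({h₁, h₂} : Set V) η * ind {η : BondConfig V | h₁ ∈ cl η.toFinset a ∧ h₂ ∉ cl η.toFinset a} η) * (∑ η : BondConfig V, rcWeightW wY q ({h₁, h₂} : Set V) η * (ind {η : BondConfig V | ({s(a, h₁)} : Set (Sym2 V)) ∪ η ∈ {η : BondConfig V | b ∈ cl η.toFinset a ∧ c ∉ cl η.toFinset a}} η * (if η ∈ {η : BondConfig V | h₂ ∈ cl η.toFinset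 h₁} then 1 else q))) + (∑ η : BondConfig V, rcWeightW wA q ({h₁, h₂} : Set V) η * ind {η : BondConfig V | h₁ ∉ cl η.toFinset a ∧ h₂ ∈ cl η.toFinset a} η) * (∑ η : BondConfig V, rcWeightW wY q ({h₁, h₂} : Set V) η * (ind {η : BondConfig V | ({s(a, h₂)} : Set (Sym2 V)) ∪ η ∈ {η : BondConfig V | b ∈ cl η.toFinset a ∧ c ∉ cl η.toFinset a}} η * (if η ∈ {η : BondConfig V | h₂ ∈ cl η.toFinset h₁} then 1 else q))) ∧
    (∑ ω : BondConfig V, rcWeightW w q ∅ ω * ind {η : BondConfig V | b ∉ cl η.toFinset a ∧ c ∈ cl η.toFinset a} ω) * q ^ clusterCount (∅ : BondConfig V) ({h₁, h₂} : Set V) = (∑ η : BondConfig V, rcWeightW wA q ({h₁, h₂} : Set V) η * ind {η : BondConfig V | h₁ ∈ cl η.toFinset a ∧ h₂ ∈ cl η.toFinset a} η) * (∑ η : BondConfig V, rcWeightW wY q ({h₁, h₂} : Set V) η * ind {η : BondConfig V | ({s(a, h₁), s(a, h₂)} : Set (Sym2 V)) ∪ η ∈ {η : BondConfig V | b ∉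 cl η.toFinset a ∧ c ∈ cl η.toFinset a}} η) + (∑ η : BondConfig V, rcWeightW wA q ({h₁, h₂} : Set V) η * ind {η : BondConfig V | h₁ ∈ cl η.toFinset a ∧ h₂ ∉ cl η.toFinset a} η) * (∑ η : BondConfig V, rcWeightW wY q ({h₁, h₂} : Set V) η * (ind {η : BondConfig V | ({s(a, h₁)} : Set (Sym2 V)) ∪ η ∈ {η : BondConfig V | b ∉ cl η.toFinset a ∧ c ∈ cl η.toFinset a}} η * (if η ∈ {η : BondConfig V | h₂ ∈ cl η.toFinset h₁} then 1 else q))) + (∑ η : BondConfig V, rcWeightW wA q ({h₁, h₂} : Set V) η * ind {η : BondConfig V | h₁ ∉ cl η.toFinset a ∧ h₂ ∈ cl η.toFinset a} η) * (∑ η : BondConfig V, rcWeightW wY q ({h₁, h₂} : Set V) η * (ind {η : BondConfig V | ({s(a, h₂)} : Set (Sym2 V)) ∪ η ∈ {η : BondConfig V | b ∉ cl η.toFinset a ∧ c ∈ cl η.toFinset a}} η * (if η ∈ {η : BondConfig V | h₂ ∈ cl η.toFinset h₁} then 1 else q))) ∧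
    (∑ ω : BondConfig V, rcWeightW w q ∅ ω * ind {η : BondConfig V | b ∉ cl η.toFinset a ∧ c ∉ cl η.toFinset a ∧ Sep (DA ∪ DY) (cl η.toFinset a) b c} ω) * q ^ clusterCount (∅ : BondConfig V) ({h₁, h₂} : Set V) = (∑ η : BondConfig V, rcWeightW wA q ({h₁, h₂} : Set V) η * ind {η : BondConfig V | h₁ ∈ cl η.toFinset a ∧ h₂ ∈ cl η.toFinset a} η) * (∑ η : BondConfig V, rcWeightW wY q ({h₁, h₂} : Set V) η * ind {η : BondConfig V | ({s(a, h₁), s(a, h₂)} : Set (Sym2 V)) ∪ η ∈ {η : BondConfig V | b ∉ cl η.toFinset a ∧ c ∉ cl η.toFinset a ∧ Sep (({s(a, h₁), s(a, h₂), s(h₁, h₂)} : Finset (Sym2 V)) ∪ DY) (cl η.toFinset a) b c}} η) + (∑ η : BondConfig V, rcWeightW wA q ({h₁, h₂} : Set V) η * ind {η : BondConfig V | h₁ ∈ cl η.toFinset a ∧ h₂ ∉ cl η.toFinset a} η) * (∑ η : BondConfig V, rcWeightW wY q ({h₁, h₂} : Set V) η * (ind {η : BondConfig V | ({s(a, h₁)}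 : Set (Sym2 V)) ∪ η ∈ {η : BondConfig V | b ∉ cl η.toFinset a ∧ c ∉ cl η.toFinset a ∧ Sep (({s(a, h₁), s(a, h₂), s(h₁, h₂)} : Finset (Sym2 V)) ∪ DY) (cl η.toFinset a) b c}} η * (if η ∈ {η : BondConfig V | h₂ ∈ cl η.toFinset h₁} then 1 else q))) + (∑ η : BondConfig V, rcWeightW wA q ({h₁, h₂} : Set V) η * ind {η : BondConfig V | h₁ ∉ cl η.toFinset a ∧ h₂ ∈ cl η.toFinset a} η) * (∑ η : BondConfig V, rcWeightW wY q ({h₁, h₂} : Set V) η * (ind {η : BondConfig V | ({s(a, h₂)} : Set (Sym2 V)) ∪ η ∈ {η : BondConfig V | b ∉ cl η.toFinset a ∧ c ∉ cl η.toFinset a ∧ Sep (({s(a, h₁), s(a, h₂), s(h₁, h₂)} : Finset (Sym2 V)) ∪ DY) (cl η.toFinset a) b c}} η * (if η ∈ {η : BondConfig V | h₂ ∈ cl η.toFinset h₁} then 1 else q))) := by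
  have gs := g_sub (V := V) (a := a) (h₁ := h₁) (h₂ := h₂)
  have bA := bits_A (V := V) ha1 ha2
  have bB := bits_B (V := V) h12 ha1 ha2
  have bC := bits_C (V := V) h12 ha1 ha2
  have bD := bits_D (V := V) h12 ha1 ha2
  have bE := bits_E (V := V) (a := a) h12 ha1 ha2
  have mA : ∀ {ω : BondConfig V}, (ω ∩ ↑DA) ∈ {η : BondConfig V | h₁ ∈ cl η.toFinset a ∧ h₂ ∈ cl η.toFinset a} →
      (((ω ∩ ↑DA) ∈ {η : BondConfig V | h₁ ∈ cl η.toFinset a} ↔ ({s(a, h₁), s(a, h₂)} : Set (Sym2 V)) ∈ {η : BondConfig V | h₁ ∈ cl η.toFinset a}) ∧ ((ω ∩ ↑DA) ∈ {η : BondConfig V | h₂ ∈ cl η.toFinset a} ↔ ({s(a, h₁), s(a, h₂)} : Set (Sym2 V)) ∈ {η : BondConfig V | h₂ ∈ cl η.toFinset a}) ∧ ((ω ∩ ↑DA) ∈ {η : BondConfig V | h₂ ∈ cl η.toFinset h₁} ↔ ({s(a, h₁), s(a, h₂)} : Set (Sym2 V)) ∈ {η : BondConfig V | h₂ ∈ cl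 η.toFinset h₁})) := fun h =>
    ⟨iff_of_true h.1 bA.1, iff_of_true h.2 bA.2.1, iff_of_true (mem_cl_trans (mem_cl_comm.1 h.1) h.2) bA.2.2⟩
  have mC : ∀ {ω : BondConfig V}, (ω ∩ ↑DA) ∈ {η : BondConfig V | h₁ ∈ cl η.toFinset a ∧ h₂ ∉ cl η.toFinset a} →
      (((ω ∩ ↑DA) ∈ {η : BondConfig V | h₁ ∈ cl η.toFinset a} ↔ ({s(a, h₁)} : Set (Sym2 V)) ∈ {η : BondConfig V | h₁ ∈ cl η.toFinset a}) ∧ ((ω ∩ ↑DA) ∈ {η : BondConfig V | h₂ ∈ cl η.toFinset a} ↔ ({s(a, h₁)} : Set (Sym2 V)) ∈ {η : BondConfig V | h₂ ∈ cl η.toFinset a}) ∧ ((ω ∩ ↑DA) ∈ {η : BondConfig V | h₂ ∈ cl η.toFinset h₁} ↔ ({s(a, h₁)} : Set (Sym2 V)) ∈ {η : BondConfig V | h₂ ∈ cl η.toFinset h₁})) := fun h =>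
    ⟨iff_of_true h.1 bC.1, iff_of_false h.2 bC.2.1, iff_of_false (fun hj => h.2 (mem_cl_trans h.1 hj)) bC.2.2⟩
  have mD : ∀ {ω : BondConfig V}, (ω ∩ ↑DA) ∈ {η : BondConfig V | h₁ ∉ cl η.toFinset a ∧ h₂ ∈ cl η.toFinset a} →
      (((ω ∩ ↑DA) ∈ {η : BondConfig V | h₁ ∈ cl η.toFinset a} ↔ ({s(a, h₂)} : Set (Sym2 V)) ∈ {η : BondConfig V | h₁ ∈ cl η.toFinset a}) ∧ ((ω ∩ ↑DA) ∈ {η : BondConfig V | h₂ ∈ cl η.toFinset a} ↔ ({s(a, h₂)} : Set (Sym2 V)) ∈ {η : BondConfig V | h₂ ∈ cl η.toFinset a}) ∧ ((ω ∩ ↑DA) ∈ {η : BondConfig V | h₂ ∈ cl η.toFinset h₁} ↔ ({s(a, h₂)} : Set (Sym2 V)) ∈ {η : BondConfig V | h₂ ∈ cl η.toFinset h₁})) := fun h =>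
    ⟨iff_of_false h.1 bD.1, iff_of_true h.2 bD.2.1, iff_of_false (fun hj => h.1 (mem_cl_trans h.2 (mem_cl_comm.1 hj))) bD.2.2⟩
  have mB : ∀ {ω : BondConfig V}, (ω ∩ ↑DA) ∈ {η : BondConfig V | h₁ ∉ cl η.toFinset a ∧ h₂ ∉ cl η.toFinset a ∧ h₂ ∈ cl η.toFinset h₁} →
      (((ω ∩ ↑DA) ∈ {η : BondConfig V | h₁ ∈ cl η.toFinset a} ↔ ({s(h₁, h₂)} : Set (Sym2 V)) ∈ {η : BondConfig V | h₁ ∈ cl η.toFinset a}) ∧ ((ω ∩ ↑DA) ∈ {η : BondConfig V | h₂ ∈ cl η.toFinset a} ↔ ({s(h₁, h₂)} : Set (Sym2 V)) ∈ {η : BondConfig V | h₂ ∈ cl η.toFinset a}) ∧ ((ω ∩ ↑DA) ∈ {η : BondConfig V | h₂ ∈ cl η.toFinset h₁} ↔ ({s(h₁, h₂)} : Set (Sym2 V)) ∈ {η : BondConfig V | h₂ ∈ cl η.toFinset h₁})) := fun h =>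
    ⟨iff_of_false h.1 bB.1, iff_of_false h.2.1 bB.2.1, iff_of_true h.2.2 bB.2.2⟩
  have mE : ∀ {ω : BondConfig V}, (ω ∩ ↑DA) ∈ {η : BondConfig V | h₁ ∉ cl η.toFinset a ∧ h₂ ∉ cl η.toFinset a ∧ h₂ ∉ cl η.toFinset h₁} →
      (((ω ∩ ↑DA) ∈ {η : BondConfig V | h₁ ∈ cl η.toFinset a} ↔ (∅ : Set (Sym2 V)) ∈ {η : BondConfig V | h₁ ∈ cl η.toFinset a}) ∧ ((ω ∩ ↑DA) ∈ {η : BondConfig V | h₂ ∈ cl η.toFinset a} ↔ (∅ : Set (Sym2 V)) ∈ {η : BondConfig V | h₂ ∈ cl η.toFinset a}) ∧ ((ω ∩ ↑DA) ∈ {η : BondConfig V | h₂ ∈ cl η.toFinset h₁} ↔ (∅ : Set (Sym2 V)) ∈ {η : BondConfig V | h₂ ∈ cl η.toFinset h₁})) := fun h =>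
    ⟨iff_of_false h.1 bE.1, iff_of_false h.2.1 bE.2.1, iff_of_false h.2.2 bE.2.2⟩
  have eT := sum_eq (q := q) h12 hsepD w wA wY hw hX hX' hY hY' (EG := {η : BondConfig V | b ∈ cl η.toFinset a ∧ c ∈ cl η.toFinset a}) (E := {η : BondConfig V | b ∈ cl η.toFinset a ∧ c ∈ cl η.toFinset a})
    (fun ω hω hs => (rep_cells hsepD haY hb hc hω gs.1 (mA hs).1 (mA hs).2.1 (mA hs).2.2).1)
    (fun ω hω hs => (rep_cells hsepD haY hb hc hω gs.2.1 (mB hs).1 (mB hs).2.1 (mB hs).2.2).1)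
    (fun ω hω hs => (rep_cells hsepD haY hb hc hω gs.2.2.1 (mC hs).1 (mC hs).2.1 (mC hs).2.2).1)
    (fun ω hω hs => (rep_cells hsepD haY hb hc hω gs.2.2.2.1 (mD hs).1 (mD hs).2.1 (mD hs).2.2).1)
    (fun ω hω hs => (rep_cells hsepD haY hb hc hω gs.2.2.2.2 (mE hs).1 (mE hs).2.1 (mE hs).2.2).1)
  have eUb := sum_eq (q := q) h12 hsepD w wA wY hw hX hX' hY hY' (EG := {η : BondConfig V | b ∈ cl η.toFinset a ∧ c ∉ cl η.toFinset a}) (E := {η : BondConfig V | b ∈ cl η.toFinset a ∧ c ∉ cl η.toFinset a})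
    (fun ω hω hs => (rep_cells hsepD haY hb hc hω gs.1 (mA hs).1 (mA hs).2.1 (mA hs).2.2).2.1)
    (fun ω hω hs => (rep_cells hsepD haY hb hc hω gs.2.1 (mB hs).1 (mB hs).2.1 (mB hs).2.2).2.1)
    (fun ω hω hs => (rep_cells hsepD haY hb hc hω gs.2.2.1 (mC hs).1 (mC hs).2.1 (mC hs).2.2).2.1)
    (fun ω hω hs => (rep_cells hsepD haY hb hc hω gs.2.2.2.1 (mD hs).1 (mD hs).2.1 (mD hs).2.2).2.1)
    (fun ω hω hs => (rep_cells hsepD haY hb hc hω gs.2.2.2.2 (mE hs).1 (mE hs).2.1 (mE hs).2.2).2.1)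
  have eUc := sum_eq (q := q) h12 hsepD w wA wY hw hX hX' hY hY' (EG := {η : BondConfig V | b ∉ cl η.toFinset a ∧ c ∈ cl η.toFinset a}) (E := {η : BondConfig V | b ∉ cl η.toFinset a ∧ c ∈ cl η.toFinset a})
    (fun ω hω hs => (rep_cells hsepD haY hb hc hω gs.1 (mA hs).1 (mA hs).2.1 (mA hs).2.2).2.2)
    (fun ω hω hs => (rep_cells hsepD haY hb hc hω gs.2.1 (mB hs).1 (mB hs).2.1 (mB hs).2.2).2.2)
    (fun ω hω hs => (rep_cells hsepD haY hb hc hω gs.2.2.1 (mC hs).1 (mC hs).2.1 (mC hs).2.2).2.2)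
    (fun ω hω hs => (rep_cells hsepD haY hb hc hω gs.2.2.2.1 (mD hs).1 (mD hs).2.1 (mD hs).2.2).2.2)
    (fun ω hω hs => (rep_cells hsepD haY hb hc hω gs.2.2.2.2 (mE hs).1 (mE hs).2.1 (mE hs).2.2).2.2)
  have eS := sum_eq (q := q) h12 hsepD w wA wY hw hX hX' hY hY' (EG := {η : BondConfig V | b ∉ cl η.toFinset a ∧ c ∉ cl η.toFinset a ∧ Sep (DA ∪ DY) (cl η.toFinset a) b c}) (E := {η : BondConfig V | b ∉ cl η.toFinset a ∧ c ∉ cl η.toFinset a ∧ Sep (({s(a, h₁), s(a, h₂), s(h₁, h₂)} : Finset (Sym2 V)) ∪ DY) (cl η.toFinset a) b c})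
    (fun ω hω hs => rep_S h12 hab hac hsepD haY hb hc hbc hω gs.1 (mA hs).1 (mA hs).2.1 (mA hs).2.2)
    (fun ω hω hs => rep_S h12 hab hac hsepD haY hb hc hbc hω gs.2.1 (mB hs).1 (mB hs).2.1 (mB hs).2.2)
    (fun ω hω hs => rep_S h12 hab hac hsepD haY hb hc hbc hω gs.2.2.1 (mC hs).1 (mC hs).2.1 (mC hs).2.2)
    (fun ω hω hs => rep_S h12 hab hac hsepD haY hb hc hbc hω gs.2.2.2.1 (mD hs).1 (mD hs).2.1 (mD hs).2.2)
    (fun ω hω hs => rep_S h12 hab hac hsepD haY hb hc hbc hω gs.2.2.2.2 (mE hs).1 (mE hs).2.1 (mE hs).2.2)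
  have hgB : ∀ e ∈ ({s(h₁, h₂)} : Set (Sym2 V)), a ∉ e := fun e he hae => by
    rw [Set.mem_singleton_iff] at he; subst he; exact (Sym2.mem_iff.1 hae).elim ha1 ha2
  have hgE : ∀ e ∈ (∅ : Set (Sym2 V)), a ∉ e := fun e he _ => he
  have cB := fun (η : BondConfig V) (hη : η ⊆ (↑DY : Set (Sym2 V))) => cells_empty_of_isolated (h₁ := h₁) (h₂ := h₂) hab hac haY hbc ({s(h₁, h₂)} : Set (Sym2 V)) hgB η hη
  have cE := fun (η : BondConfig V) (hη : η ⊆ (↑DY : Set (Sym2 V))) => cells_empty_of_isolated (h₁ := h₁) (h₂ := h₂) hab hac haY hbc (∅ : Set (Sym2 V)) hgE η hη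
  have vBT : (∑ η : BondConfig V, rcWeightW wY q ({h₁, h₂} : Set V) η * ind {η : BondConfig V | ({s(h₁, h₂)} : Set (Sym2 V)) ∪ η ∈ {η : BondConfig V | b ∈ cl η.toFinset a ∧ c ∈ cl η.toFinset a}} η) = 0 := by
    have h := row_vanish (h₁ := h₁) (h₂ := h₂) (q := q) w wY hw hY hY' ({s(h₁, h₂)} : Set (Sym2 V)) (fun _ => 1) (fun η hη => (cB η hη).1)
    simp only [mul_one] at h; exact h
  have vBUb : (∑ η : BondConfig V, rcWeightW wY q ({h₁, h₂} : Set V) η * ind {η : BondConfig V | ({s(h₁, h₂)} : Set (Sym2 V)) ∪ η ∈ {η : BondConfig V | b ∈ cl η.toFinset a ∧ c ∉ cl η.toFinset a}} η) = 0 := by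
    have h := row_vanish (h₁ := h₁) (h₂ := h₂) (q := q) w wY hw hY hY' ({s(h₁, h₂)} : Set (Sym2 V)) (fun _ => 1) (fun η hη => (cB η hη).2.1)
    simp only [mul_one] at h; exact h
  have vBUc : (∑ η : BondConfig V, rcWeightW wY q ({h₁, h₂} : Set V) η * ind {η : BondConfig V | ({s(h₁, h₂)} : Set (Sym2 V)) ∪ η ∈ {η : BondConfig V | b ∉ cl η.toFinset a ∧ c ∈ cl η.toFinset a}} η) = 0 := by
    have h := row_vanish (h₁ := h₁) (h₂ := h₂) (q := q) w wY hw hY hY' ({s(h₁, h₂)} : Set (Sym2 V)) (fun _ => 1) (fun η hη => (cB η hη).2.2.1)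
    simp only [mul_one] at h; exact h
  have vBS : (∑ η : BondConfig V, rcWeightW wY q ({h₁, h₂} : Set V) η * ind {η : BondConfig V | ({s(h₁, h₂)} : Set (Sym2 V)) ∪ η ∈ {η : BondConfig V | b ∉ cl η.toFinset a ∧ c ∉ cl η.toFinset a ∧ Sep (({s(a, h₁), s(a, h₂), s(h₁, h₂)} : Finset (Sym2 V)) ∪ DY) (cl η.toFinset a) b c}} η) = 0 := by
    have h := row_vanish (h₁ := h₁) (h₂ := h₂) (q := q) w wY hw hY hY' ({s(h₁, h₂)} : Set (Sym2 V)) (fun _ => 1) (fun η hη => (cB η hη).2.2.2)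
    simp only [mul_one] at h; exact h
  have vET : (∑ η : BondConfig V, rcWeightW wY q ({h₁, h₂} : Set V) η * (ind {η : BondConfig V | (∅ : Set (Sym2 V)) ∪ η ∈ {η : BondConfig V | b ∈ cl η.toFinset a ∧ c ∈ cl η.toFinset a}} η * (if η ∈ {η : BondConfig V | h₂ ∈ cl η.toFinset h₁} then 1 else q))) = 0 := row_vanish (h₁ := h₁) (h₂ := h₂) (q := q) w wY hw hY hY' (∅ : Set (Sym2 V)) _ (fun η hη => (cE η hη).1)
  have vEUb : (∑ η : BondConfig V, rcWeightW wY q ({h₁, h₂} : Set V) η * (ind {η : BondConfig V | (∅ : Set (Sym2 V)) ∪ η ∈ {η : BondConfig V | b ∈ cl η.toFinset a ∧ c ∉ cl η.toFinset a}} η * (if η ∈ {η : BondConfig V | h₂ ∈ cl η.toFinset h₁} then 1 else q))) = 0 := row_vanish (h₁ := h₁) (h₂ := h₂) (q := q) w wY hw hY hY' (∅ : Set (Sym2 V)) _ (fun η hη => (cE η hη).2.1)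
  have vEUc : (∑ η : BondConfig V, rcWeightW wY q ({h₁, h₂} : Set V) η * (ind {η : BondConfig V | (∅ : Set (Sym2 V)) ∪ η ∈ {η : BondConfig V | b ∉ cl η.toFinset a ∧ c ∈ cl η.toFinset a}} η * (if η ∈ {η : BondConfig V | h₂ ∈ cl η.toFinset h₁} then 1 else q))) = 0 := row_vanish (h₁ := h₁) (h₂ := h₂) (q := q) w wY hw hY hY' (∅ : Set (Sym2 V)) _ (fun η hη => (cE η hη).2.2.1)
  have vES : (∑ η : BondConfig V, rcWeightW wY q ({h₁, h₂} : Set V) η * (ind {η : BondConfig V | (∅ : Set (Sym2 V)) ∪ η ∈ {η : BondConfig V | b ∉ cl η.toFinset a ∧ c ∉ cl η.toFinset a ∧ Sep (({s(a, h₁), s(a, h₂), s(h₁, h₂)} : Finset (Sym2 V)) ∪ DY) (cl η.toFinset a) b c}} η * (if η ∈ {η : BondConfig V | h₂ ∈ cl η.toFinset h₁} then 1 else q))) = 0 := row_vanish (h₁ := h₁) (h₂ := h₂) (q := q) w wY hw hY hY' (∅ : Set (Sym2 V)) _ (fun η hη => (cE η hη).2.2.2)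
  rw [eT, eUb, eUc, eS, vBT, vBUb, vBUc, vBS, vET, vEUb, vEUc, vES]
  refine ⟨by ring, by ring, by ring, by ring⟩

end CellSums

/-! ### Proportional apex arms give the same R1 verdict -/

section Proportional

omit [Fintype V] in
/-- A three-term linear form at proportional arguments. [folklore] -/
theorem lin_prop {xA xC xD yA yC yD rA rC rD : ℝ} (hC : yC * xA = yA * xC) (hD : yD * xA = yA * xD) :
    (yA * rA + yC * rC + yD * rD) * xA = yA * (xA * rA + xC * rC + xD * rD) := by
  linear_combination rC * hC + rD * hD

omit [Fintype V] in
/-- **R1 verdicts agree along a ray**: if `(y_A, y_C, y_D) ∥ (x_A, x_C, x_D)` with `x_A, y_A ≠ 0`, the quadratic R1 forms have the same sign. [this work] -/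
theorem r1_iff_prop {xA xC xD yA yC yD aT cT dT aS cS dS aB cB dB aC cC dC : ℝ}
    (hxA : xA ≠ 0) (hyA : yA ≠ 0) (hC : yC * xA = yA * xC) (hD : yD * xA = yA * xD) :
    ((xA * aT + xC * cT + xD * dT) * (xA * aS + xC * cS + xD * dS) ≤ (xA * aB + xC * cB + xD * dB) * (xA * aC + xC * cC + xD * dC)) ↔
      ((yA * aT + yC * cT + yD * dT) * (yA * aS + yC * cS + yD * dS) ≤ (yA * aB + yC * cB + yD * dB) * (yA * aC + yC * cC + yD * dC)) := by
  have eT := lin_prop (rA := aT) (rC := cT) (rD := dT) hC hD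
  have eS := lin_prop (rA := aS) (rC := cS) (rD := dS) hC hD
  have eB := lin_prop (rA := aB) (rC := cB) (rD := dB) hC hD
  have eC := lin_prop (rA := aC) (rC := cC) (rD := dC) hC hD
  have hx2 : 0 < xA * xA := mul_self_pos.2 hxA
  have hy2 : 0 < yA * yA := mul_self_pos.2 hyA
  constructor
  · intro h
    have h1 := mul_le_mul_of_nonneg_left h hy2.le
    have key : ∀ u v : ℝ, yA * yA * (u * v) = (yA * u) * (yA * v) := fun u v => by ring
    rw [key, key, ← eT, ← eS, ← eB, ← eC] at h1
    have h2 : ((yA * aT + yC * cT + yD * dT) * (yA * aS + yC * cS + yD * dS)) * (xA * xA) ≤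
        ((yA * aB + yC * cB + yD * dB) * (yA * aC + yC * cC + yD * dC)) * (xA * xA) := by
      have e1 : ∀ u v : ℝ, (u * xA) * (v * xA) = (u * v) * (xA * xA) := fun u v => by ring
      rwa [e1, e1] at h1
    exact le_of_mul_le_mul_right h2 hx2
  · intro h
    have h1 := mul_le_mul_of_nonneg_right h hx2.le
    have e1 : ∀ u v : ℝ, (u * v) * (xA * xA) = (u * xA) * (v * xA) := fun u v => by ring
    rw [e1, e1, eT, eS, eB, eC] at h1
    have key : ∀ u v : ℝ, (yA * u) * (yA * v) = yA * yA * (u * v) := fun u v => by ring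
    rw [key, key] at h1
    exact le_of_mul_le_mul_left h1 hy2

variable {DA DA' DY D D' : Finset (Sym2 V)} {a h₁ h₂ b c : V} (h12 : h₁ ≠ h₂) (ha1 : a ≠ h₁) (ha2 : a ≠ h₂) (hab : a ≠ b) (hac : a ≠ c)
  (hsepD : ∀ z : V, (∃ e ∈ DA, z ∈ e) → (∃ e ∈ DY, z ∈ e) → (z = h₁ ∨ z = h₂))
  (hsepD' : ∀ z : V, (∃ e ∈ DA', z ∈ e) → (∃ e ∈ DY, z ∈ e) → (z = h₁ ∨ z = h₂)) (haY : ∀ e ∈ DY, a ∉ e)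
  (hb : ∀ e ∈ DA, b ∈ e → (b = h₁ ∨ b = h₂)) (hc : ∀ e ∈ DA, c ∈ e → (c = h₁ ∨ c = h₂))
  (hb' : ∀ e ∈ DA', b ∈ e → (b = h₁ ∨ b = h₂)) (hc' : ∀ e ∈ DA', c ∈ e → (c = h₁ ∨ c = h₂)) (hbc : c ∈ cl DY b)
  (hD : ∀ e, e ∈ D ↔ e ∈ DA ∨ e ∈ DY) (hD' : ∀ e, e ∈ D' ↔ e ∈ DA' ∨ e ∈ DY)
  (w w' wA wA' wY : Sym2 V → unitInterval) {q : ℝ} (hq : 0 < q)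
  (hw : ∀ e, e ∉ (↑DA ∪ ↑DY : Set (Sym2 V)) → (w e : ℝ) = 0) (hw' : ∀ e, e ∉ (↑DA' ∪ ↑DY : Set (Sym2 V)) → (w' e : ℝ) = 0)
  (hX : ∀ e ∈ (↑DA : Set (Sym2 V)), wA e = w e) (hX' : ∀ e ∉ (↑DA : Set (Sym2 V)), wA e = 0)
  (hY : ∀ e ∈ (↑DA : Set (Sym2 V)), wY e = 0) (hY' : ∀ e ∉ (↑DA : Set (Sym2 V)), wY e = w e)
  (gX : ∀ e ∈ (↑DA' : Set (Sym2 V)), wA' e = w' e) (gX' : ∀ e ∉ (↑DA' : Set (Sym2 V)), wA' e = 0)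
  (gY : ∀ e ∈ (↑DA' : Set (Sym2 V)), wY e = 0) (gY' : ∀ e ∉ (↑DA' : Set (Sym2 V)), wY e = w' e)
include h12 ha1 ha2 hab hac hsepD hsepD' haY hb hc hb' hc' hbc hD hD' hq hw hw' hX hX' hY hY' gX gX' gY gY'

/-- **Apex-arm folding**: two apex arms glued to the same rest with proportional wired masses `((∑ η : BondConfig V, rcWeightW wA q ({h₁, h₂} : Set V) η * ind {η : BondConfig V | h₁ ∈ cl η.toFinset a ∧ h₂ ∈ cl η.toFinset a} η), (∑ η : BondConfig V, rcWeightW wA q ({h₁, h₂} : Set V) η * ind {η : BondConfig V | h₁ ∈ cl η.toFinset a ∧ h₂ ∉ cl η.toFinset a} η), (∑ η : BondConfig V, rcWeightW wA q ({h₁, h₂} : Set V) η * ind {η : BondConfig V | h₁ ∉ cl η.toFinset a ∧ h₂ ∈ cl η.toFinset a} η))` give glued graphs on which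
R1 for `(a; b, c)` is equivalent. [this work] -/
theorem r1_iff_of_proportional (hXA : (∑ η : BondConfig V, rcWeightW wA q ({h₁, h₂} : Set V) η * ind {η : BondConfig V | h₁ ∈ cl η.toFinset a ∧ h₂ ∈ cl η.toFinset a} η) ≠ 0) (hXA' : (∑ η : BondConfig V, rcWeightW wA' q ({h₁, h₂} : Set V) η * ind {η : BondConfig V | h₁ ∈ cl η.toFinset a ∧ h₂ ∈ cl η.toFinset a} η) ≠ 0)
    (hpC : (∑ η : BondConfig V, rcWeightW wA' q ({h₁, h₂} : Set V) η * ind {η : BondConfig V | h₁ ∈ cl η.toFinset a ∧ h₂ ∉ cl η.toFinset a} η) * (∑ η : BondConfig V, rcWeightW wA q ({h₁, h₂} : Set V) η * ind {η : BondConfig V | h₁ ∈ cl η.toFinset a ∧ h₂ ∈ cl η.toFinset a} η) = (∑ η : BondConfig V, rcWeightW wA' q ({h₁, h₂} : Set V) η * ind {η : BondConfig V | h₁ ∈ cl η.toFinset a ∧ h₂ ∈ cl η.toFinset a} η) * (∑ η : BondConfig V, rcWeightW wA q ({h₁, h₂} : Set V) η * ind {η : BondConfig V | h₁ ∈ cl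 η.toFinset a ∧ h₂ ∉ cl η.toFinset a} η)) (hpD : (∑ η : BondConfig V, rcWeightW wA' q ({h₁, h₂} : Set V) η * ind {η : BondConfig V | h₁ ∉ cl η.toFinset a ∧ h₂ ∈ cl η.toFinset a} η) * (∑ η : BondConfig V, rcWeightW wA q ({h₁, h₂} : Set V) η * ind {η : BondConfig V | h₁ ∈ cl η.toFinset a ∧ h₂ ∈ cl η.toFinset a} η) = (∑ η : BondConfig V, rcWeightW wA' q ({h₁, h₂} : Set V) η * ind {η : BondConfig V | h₁ ∈ cl η.toFinset a ∧ h₂ ∈ cl η.toFinset a} η) * (∑ η : BondConfig V, rcWeightW wA q ({h₁, h₂} : Set V) η * ind {η : BondConfig V | h₁ ∉ cl η.toFinset a ∧ h₂ ∈ cl η.toFinset a} η)) :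
    ((rcMeasureW w q ∅).real {η : BondConfig V | b ∈ cl η.toFinset a ∧ c ∈ cl η.toFinset a} * (rcMeasureW w q ∅).real {η : BondConfig V | b ∉ cl η.toFinset a ∧ c ∉ cl η.toFinset a ∧ Sep D (cl η.toFinset a) b c} ≤ (rcMeasureW w q ∅).real {η : BondConfig V | b ∈ cl η.toFinset a ∧ c ∉ cl η.toFinset a} * (rcMeasureW w q ∅).real {η : BondConfig V | b ∉ cl η.toFinset a ∧ c ∈ cl η.toFinset a}) ↔ ((rcMeasureW w' q ∅).real {η : BondConfig V | b ∈ cl η.toFinset a ∧ c ∈ cl η.toFinset a} * (rcMeasureW w' q ∅).real {η : BondConfig V | b ∉ cl η.toFinset a ∧ c ∉ cl η.toFinset a ∧ Sep D' (cl η.toFinset a) b c} ≤ (rcMeasureW w' q ∅).real {η : BondConfig V | b ∈ cl η.toFinset a ∧ c ∉ cl η.toFinset a} * (rcMeasureW w' q ∅).real {η : BondConfig V | b ∉ cl η.toFinset a ∧ c ∈ cl η.toFinset a}) := by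
  have hDD : D = DA ∪ DY := by ext e; rw [Finset.mem_union]; exact hD e
  have hDD' : D' = DA' ∪ DY := by ext e; rw [Finset.mem_union]; exact hD' e
  subst hDD hDD'
  have hZ := rcPartitionFunctionW_pos w hq (∅ : Set V)
  have hZ' := rcPartitionFunctionW_pos w' hq (∅ : Set V)
  have hK : 0 < q ^ clusterCount (∅ : BondConfig V) ({h₁, h₂} : Set V) := pow_pos hq _
  obtain ⟨eT, eUb, eUc, eS⟩ := cell_sums h12 ha1 ha2 hab hac hsepD haY hb hc hbc w wA wY hw hX hX' hY hY'
  obtain ⟨eT', eUb', eUc', eS'⟩ := cell_sums h12 ha1 ha2 hab hac hsepD' haY hb' hc' hbc w' wA' wY hw' gX gX' gY gY'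
  have hxyK : ∀ x y K : ℝ, x * y * (K * K) = (x * K) * (y * K) := fun x y K => by ring
  simp only [rcMeasureW_real_eq_sum_div w hq, rcMeasureW_real_eq_sum_div w' hq]
  rw [div_mul_div_comm, div_mul_div_comm, div_le_div_iff_of_pos_right (mul_pos hZ hZ),
    div_mul_div_comm, div_mul_div_comm, div_le_div_iff_of_pos_right (mul_pos hZ' hZ')]
  conv_lhs => rw [← mul_le_mul_iff_of_pos_right (mul_pos hK hK), hxyK, eT, eS, hxyK, eUb, eUc]
  conv_rhs => rw [← mul_le_mul_iff_of_pos_right (mul_pos hK hK), hxyK, eT', eS', hxyK, eUb', eUc']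
  exact r1_iff_prop hXA hXA' hpC hpD

end Proportional

end HubPairApex

end Summit.CriticalPhenomena.PercolationContinuityZ3.Theorems
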